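import Literature.NumberTheory.Automorphic.HilbertRepMinimalIdempotent
import Literature.NumberTheory.Automorphic.HilbertRepSpectrumProofs
import Literature.NumberTheory.Automorphic.HeckeEigenvectorProjection
import HarnessLib

/-!
# The idempotent datum of the trace comparison from a finite-dimensional type
(Gelbart, *Automorphic forms on adele groups* (1975), §10, p. 151: "For each `v ∈ S` we fix a
`K'_v`-finite unit vector `u'_v` in the space of `π'_v`"; p. 153, the idempotent `R'(ξ'_S)`)

Topic `NumberTheory/Automorphic`; theorems only (no definition, no named fact, no instance). Part
of the inline (D-0026) decomposition of the named fact
`Literature.NumberTheory.Automorphic.multiplicity_one_quaternionUnits` (Gelbart Thm. 10.10). The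
tree's `multiplicity_one_quaternionUnits_of_testFamily` (`QuaternionUnitsMultiplicityOneOfTestFamily`)
asks, on the quaternion side, for a self-adjoint idempotent `E₂` in the bicommutant of the regular
representation, commuting with the complementary group, with `E₂ R'(k) y = c₂(k) y` on fixed
vectors for `k` in the ramified component `G'_S`, **fixing a non-zero vector of the given
constituent `π' = W₁`**. `HilbertRepMinimalIdempotent` builds such an operator from any
irreducible unitary type `(σ, u)` of `G'_S`; this file supplies the type from finite-dimensional
data, which is how it arises for `G'_S` compact modulo the centre:

* `ContRepresentation.exists_minimal_invariant_of_finiteDimensional` — a non-zero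
  finite-dimensional subspace stable under a set of operators contains a minimal non-zero stable
  subspace (least dimension).
* `ContRepresentation.exists_minimalIdempotent_of_finiteDimensional_invariant` — for a unitary
  `τ` of `Γ`, `j : K → Γ` and a non-zero finite-dimensional `τ(j K)`-stable `V`, there are `E`
  and `c : K → ℂ` with all the properties above and a non-zero `E`-fixed vector in `V` (minimal
  stable `U ≤ V`, the irreducible unitary representation of `K` on `U`, a unit vector, and
  `exists_minimalIdempotent_spec`; the inclusion `U ↪ H` is an intertwiner).
* `ContRepresentation.exists_finiteDimensional_invariant_of_finset` — from a non-zero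
  finite-dimensional subspace stable under a subset `K₀ ⊆ K` to one stable under `K`, when
  `K = T · K₀` up to scalars on the ambient invariant subspace for a finite `T` (the passage from
  the maximal compact subgroup `𝒪_{D_S}^×`, for which finite-dimensional stable subspaces come
  from the Peter–Weyl theorem, to `D_S^×`, of finite index over `𝒪_{D_S}^× · K_S^×`, the centre
  acting on an irreducible constituent by scalars).

Not here: the compact-group input (a non-zero finite-dimensional `𝒪_{D_S}^×`-stable subspace in
every non-zero closed invariant subspace; cf. `CompactGroupKFiniteVectors`) and the adelic
bookkeeping.

## References

* S. Gelbart, *Automorphic forms on adele groups*, Ann. of Math. Studies 83 (1975), §10,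
  pp. 151–153 [Gelbart1975].
-/

noncomputable section

open scoped InnerProductSpace
open Topology

namespace ContRepresentation

section FiniteType

variable {Γ K : Type*} [Group Γ] [Group K]
  {H : Type*} [NormedAddCommGroup H] [InnerProductSpace ℂ H] [CompleteSpace H]

omit [CompleteSpace H] in
/-- **A non-zero finite-dimensional subspace invariant under a set of operators contains a minimal
non-zero invariant subspace** (induction on the dimension). [folklore] -/
theorem exists_minimal_invariant_of_finiteDimensional (𝒮 : Set (H →L[ℂ] H))
    (V : Submodule ℂ H) [FiniteDimensional ℂ V] (hV0 : V ≠ ⊥)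
    (hV : ∀ A ∈ 𝒮, ∀ v ∈ V, A v ∈ V) :
    ∃ U : Submodule ℂ H, U ≤ V ∧ U ≠ ⊥ ∧ (∀ A ∈ 𝒮, ∀ v ∈ U, A v ∈ U) ∧
      ∀ U' : Submodule ℂ H, U' ≤ U → (∀ A ∈ 𝒮, ∀ v ∈ U', A v ∈ U') → U' = ⊥ ∨ U' = U := by
  classical
  -- the set of dimensions of non-zero invariant subspaces of `V` is non-empty; take the least
  let P : ℕ → Prop := fun n => ∃ U : Submodule ℂ H, U ≤ V ∧ U ≠ ⊥ ∧
    (∀ A ∈ 𝒮, ∀ v ∈ U, A v ∈ U) ∧ Module.finrank ℂ U = n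
  have hP : ∃ n, P n := ⟨_, V, le_rfl, hV0, hV, rfl⟩
  obtain ⟨U, hUV, hU0, hUinv, hUdim⟩ := Nat.find_spec hP
  refine ⟨U, hUV, hU0, hUinv, fun U' hU'U hU'inv => ?_⟩
  by_cases hU'0 : U' = ⊥
  · exact Or.inl hU'0
  · right
    haveI : FiniteDimensional ℂ U := Submodule.finiteDimensional_of_le hUV
    haveI : FiniteDimensional ℂ U' := Submodule.finiteDimensional_of_le hU'U
    have hmin : Nat.find hP ≤ Module.finrank ℂ U' :=
      Nat.find_min' hP ⟨U', hU'U.trans hUV, hU'0, hU'inv, rfl⟩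
    rw [← hUdim] at hmin
    exact Submodule.eq_of_le_of_finrank_le hU'U hmin

/-- **The idempotent datum of the trace comparison from a finite-dimensional invariant
subspace.** Let `τ` be a unitary representation of `Γ` on `H`, `j : K → Γ` a homomorphism and
`V ≤ H` a non-zero finite-dimensional subspace invariant under `τ(j K)` (for `j(K) = G'_S`
compact modulo the centre acting on a constituent `π'` of `L²(G'_F \ G'_𝔸)`: a `G'_S`-type of
`π'`). Then there are a bounded operator `E` and a function `c : K → ℂ` such that `E` is a
self-adjoint idempotent commuting with the commutant of `τ(Γ)` and with `τ(γ)` for every `γ`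
centralising `j(K)`, `E τ(j k) y = c(k) y` on `E`-fixed vectors, and **`E` fixes a non-zero
vector of `V`**: take a minimal invariant `U ≤ V` (`exists_minimal_invariant_of_finiteDimensional`),
the irreducible unitary representation `σ` of `K` on `U`, a unit vector `u ∈ U`, and the minimal
idempotent of `ContRepresentation.exists_minimalIdempotent_spec` (`c(k) = ⟪u, σ(k) u⟫`; the
inclusion `U ↪ H` is an intertwiner, so `E u = u`). This packages Gelbart's choice "fix a
`K'_v`-finite unit vector `u'_v` in the space of `π'_v`" (p. 151) and the idempotent `R'(ξ'_S)`
(p. 153) for the quaternion side of Thm. 10.10. [cite: Gelbart1975, §10, pp. 151–153] -/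
theorem exists_minimalIdempotent_of_finiteDimensional_invariant (τ : ContRepresentation ℂ Γ H)
    (hτ : τ.IsUnitary) (j : K →* Γ) (V : Submodule ℂ H) [FiniteDimensional ℂ V] (hV0 : V ≠ ⊥)
    (hV : ∀ k : K, ∀ v ∈ V, τ (j k) v ∈ V) :
    ∃ (E : H →L[ℂ] H) (c : K → ℂ),
      (∀ x y : H, ⟪E x, y⟫_ℂ = ⟪x, E y⟫_ℂ) ∧ (∀ x, E (E x) = E x) ∧
      (∀ A : H →L[ℂ] H, (∀ γ : Γ, A ∘L τ γ = τ γ ∘L A) → A ∘L E = E ∘L A) ∧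
      (∀ γ : Γ, (∀ k : K, γ * j k = j k * γ) → ∀ y, E (τ γ y) = τ γ (E y)) ∧
      (∀ (k : K) (y : H), E y = y → E (τ (j k) y) = c k • y) ∧
      ∃ x ∈ V, x ≠ 0 ∧ E x = x := by
  -- a minimal invariant subspace `U ≤ V`
  obtain ⟨U, hUV, hU0, hUinv, hUmin⟩ := exists_minimal_invariant_of_finiteDimensional
    (Set.range fun k : K => (τ (j k) : H →L[ℂ] H)) V hV0
    (by rintro _ ⟨k, rfl⟩ v hv; exact hV k v hv)
  haveI : FiniteDimensional ℂ U := Submodule.finiteDimensional_of_le hUV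
  have hUinv' : ∀ (k : K), ∀ v ∈ U, τ (j k) v ∈ U := fun k v hv => hUinv _ ⟨k, rfl⟩ v hv
  -- `U` as a closed subrepresentation of `τ ∘ j`
  let U' : ClosedSubrep (τ.restrict j) :=
    { toSubmodule := U
      apply_mem_toSubmodule := fun k v hv => hUinv' k v hv
      isClosed' := Submodule.closed_of_finiteDimensional U }
  have hres : (τ.restrict j).IsUnitary := fun k => hτ (j k)
  have hσ : U'.toContRep.IsUnitary := hres.toContRep U'
  have hσirr : U'.toContRep.IsTopIrreducible := by
    rw [ClosedSubrep.isTopIrreducible_toContRep_iff]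
    refine ⟨fun h0 => hU0 ?_, fun W' hW' => ?_⟩
    · have := congrArg (fun W : ClosedSubrep (τ.restrict j) => W.toSubmodule) h0
      simpa [U', ClosedSubrep.toSubmodule_bot] using this
    · rcases hUmin W'.toSubmodule hW' (by rintro _ ⟨k, rfl⟩ v hv; exact W'.apply_mem k hv) with
        h | h
      · left
        exact ClosedSubrep.ext fun v => by
          rw [← ClosedSubrep.mem_toSubmodule, h, ClosedSubrep.mem_bot, Submodule.mem_bot]
      · right
        exact ClosedSubrep.ext fun v => by
          rw [← ClosedSubrep.mem_toSubmodule, h]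
          rfl
  -- a unit vector of `U`
  obtain ⟨x₀, hx₀U, hx₀0⟩ := (Submodule.ne_bot_iff U).1 hU0
  have hx₀norm : ‖x₀‖ ≠ 0 := norm_ne_zero_iff.2 hx₀0
  set u : U'.toSubmodule := ⟨((‖x₀‖⁻¹ : ℝ) : ℂ) • x₀, U.smul_mem _ hx₀U⟩ with hudef
  have hu : ‖u‖ = 1 := by
    change ‖((‖x₀‖⁻¹ : ℝ) : ℂ) • x₀‖ = 1
    rw [norm_smul, Complex.norm_real, Real.norm_of_nonneg (inv_nonneg.2 (norm_nonneg _)),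
      inv_mul_cancel₀ hx₀norm]
  obtain ⟨E, hsa, hidem, hcomm, hcent, hK, hT⟩ :=
    exists_minimalIdempotent_spec τ hτ j U'.toContRep hσ hσirr u hu
  refine ⟨E, fun k => ⟪u, U'.toContRep k u⟫_ℂ, hsa, hidem, hcomm, hcent, hK, (u : H), hUV u.2,
    fun h0 => ?_, ?_⟩
  · have h1 : u = 0 := Subtype.ext h0
    rw [h1, norm_zero] at hu
    exact zero_ne_one hu
  · have h := hT U'.toSubmodule.subtypeL fun k => by
      ext v
      rfl
    simpa only [Submodule.subtypeL_apply] using h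

omit [CompleteSpace H] in
/-- **From a type of a subgroup of finite index modulo scalars to a type of the whole group**
(the passage from the maximal compact `𝒪_{D_S}^×` to `D_S^×`, compact modulo the centre). Let
`τ` be a representation of `Γ`, `j : K → Γ`, `W ≤ H` a subspace stable under `τ(j K)` on which,
for a finite set `T ⊆ K` and a subset `K₀ ⊆ K`, every `τ(j (k t))` (`k ∈ K`, `t ∈ T`) agrees with a
scalar multiple of some `τ(j (t' k₀))` (`t' ∈ T`, `k₀ ∈ K₀`) — e.g. `K = T · K₀ · Z` with `K₀`
normalised by `T` and `Z` acting on `W` by scalars (Schur, for `W` an irreducible constituent and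
`j(Z)` central). Then every non-zero finite-dimensional `τ(j K₀)`-stable `V₀ ≤ W` generates a non-zero
finite-dimensional `τ(j K)`-stable `V ≤ W` (if `T ≠ ∅`), namely `Σ_{t ∈ T} τ(j t) V₀`.
[cite: Gelbart1975, §10, p. 151] -/
theorem exists_finiteDimensional_invariant_of_finset (τ : ContRepresentation ℂ Γ H) (j : K →* Γ)
    (W : Submodule ℂ H) (hW : ∀ k : K, ∀ w ∈ W, τ (j k) w ∈ W) (K₀ : Set K) (T : Finset K)
    (hT : T.Nonempty)
    (hdec : ∀ k : K, ∀ t ∈ T, ∃ t' ∈ T, ∃ k₀ ∈ K₀, ∃ c : ℂ, ∀ w ∈ W,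
      τ (j (k * t)) w = c • τ (j (t' * k₀)) w)
    (V₀ : Submodule ℂ H) [FiniteDimensional ℂ V₀] (hV₀W : V₀ ≤ W) (hV₀0 : V₀ ≠ ⊥)
    (hV₀ : ∀ k₀ ∈ K₀, ∀ v ∈ V₀, τ (j k₀) v ∈ V₀) :
    ∃ V : Submodule ℂ H, FiniteDimensional ℂ V ∧ V ≤ W ∧ V ≠ ⊥ ∧
      ∀ k : K, ∀ v ∈ V, τ (j k) v ∈ V := by
  classical
  set V : Submodule ℂ H := T.sup fun t => V₀.map ((τ (j t) : H →L[ℂ] H) : H →ₗ[ℂ] H) with hVdef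
  have hmem_of : ∀ t ∈ T, ∀ v ∈ V₀, τ (j t) v ∈ V := fun t ht v hv =>
    (Finset.le_sup (f := fun t => V₀.map ((τ (j t) : H →L[ℂ] H) : H →ₗ[ℂ] H)) ht) ⟨v, hv, rfl⟩
  refine ⟨V, ?_, ?_, ?_, ?_⟩
  · rw [hVdef]
    exact Submodule.finiteDimensional_finset_sup _ _
  · rw [hVdef, Finset.sup_le_iff]
    intro t ht
    rintro _ ⟨v, hv, rfl⟩
    exact hW t v (hV₀W hv)
  · obtain ⟨t₀, ht₀⟩ := hT
    obtain ⟨v, hv, hv0⟩ := (Submodule.ne_bot_iff V₀).1 hV₀0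
    refine (Submodule.ne_bot_iff V).2 ⟨τ (j t₀) v, hmem_of t₀ ht₀ v hv, fun h0 => hv0 ?_⟩
    have h1 : τ (j t₀⁻¹) (τ (j t₀) v) = v := by
      rw [← ContinuousLinearMap.comp_apply, ← ContinuousLinearMap.mul_def, ← map_mul, ← map_mul,
        inv_mul_cancel, map_one, map_one]
      rfl
    rw [← h1, h0, map_zero]
  · -- `V` is the span of the `τ(j t) V₀`; check invariance on generators
    have hVspan : V = Submodule.span ℂ (⋃ t ∈ T, (τ (j t)) '' (V₀ : Set H)) := by
      rw [hVdef, Submodule.span_iUnion₂]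
      refine le_antisymm (Finset.sup_le fun t ht => ?_) (iSup₂_le fun t ht => ?_)
      · intro x hx
        obtain ⟨v, hv, rfl⟩ := hx
        exact Submodule.mem_iSup_of_mem t
          (Submodule.mem_iSup_of_mem ht (Submodule.subset_span ⟨v, hv, rfl⟩))
      · rw [Submodule.span_le]
        rintro _ ⟨v, hv, rfl⟩
        exact hmem_of t ht v hv
    intro k v hv
    rw [hVspan] at hv ⊢
    induction hv using Submodule.span_induction with
    | mem x hx =>
      obtain ⟨t, ht, hx⟩ := Set.mem_iUnion₂.1 hx
      obtain ⟨v, hv, rfl⟩ := hx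
      obtain ⟨t', ht', k₀, hk₀, c, hc⟩ := hdec k t ht
      have e1 : τ (j k) (τ (j t) v) = τ (j (k * t)) v := by
        rw [map_mul, map_mul]
        rfl
      have e2 : τ (j (t' * k₀)) v = τ (j t') (τ (j k₀) v) := by
        rw [map_mul, map_mul]
        rfl
      rw [e1, hc v (hV₀W hv), e2]
      exact Submodule.smul_mem _ c
        (Submodule.subset_span (Set.mem_iUnion₂.2 ⟨t', ht', _, hV₀ k₀ hk₀ v hv, rfl⟩))
    | zero => rw [map_zero]; exact Submodule.zero_mem _
    | add x y _ _ hx hy => rw [map_add]; exact Submodule.add_mem _ hx hy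
    | smul a x _ hx => rw [map_smul]; exact Submodule.smul_mem _ a hx

end FiniteType

end ContRepresentation
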